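import Summits.Ventures.LatticeQCDFlow.Scaling.ClusteringFloorIffCrossCut

/-!
HONEST FRAMING: exact (Metropolis-corrected) sampling algorithms for lattice gauge theory; figures
of merit are autocorrelation/cost numbers at stated couplings and volumes; no continuum-physics
claim.

# CrossCutFloorAnySeparation — A VOLUME-UNIFORM FLOOR AT ANY ONE SEPARATION GIVES THE FLOOR AT
# SEPARATION ONE, HENCE (U″): AT EVERY `β > 0` THE WHOLE FAMILY {(U′)_R : R ∈ ℕ} ∪ {(U″)} IS ONE
# CONJECTURE (lean-1 GEN-11, ours)

Venture-side (OURS). Cell `lqcd-flow` (pub-lqcd), unit `pub-lqcd-lean-1-g11`, 2026-08-23.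
`ClusteringFloorIffCrossCut` proved (U″) ⇔ (U′) at `R = 0`.  This file removes the `R = 0`:
on every torus `L ≥ 3` at `β ≥ 0` the truncated temporal correlator `g` of a spatial plaquette is
log-convex (`PlaquetteCorrelatorFloor.sq_tCorr_le`, reflection positivity), periodic
(`g(L − a) = g(a)`) and has `0 ≤ g(1) ≤ g(0)`; three elementary facts about such sequences —

* `logConvex_eq_zero_of_one_eq_zero` — if `g(1) = 0` then `g` vanishes at every interior index;
* `ratio_le_of_logConvex` — for a positive log-convex sequence the ratios `g(n)/g(n−1)` are
  non-decreasing (chained form `g(a) g(b−1) ≤ g(b) g(a−1)`, `1 ≤ a ≤ b`);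
* `le_pred_of_logConvex_symm`, `le_one_of_logConvex_symm` — a positive, log-convex, `L`-symmetric
  sequence is NON-INCREASING up to the middle: `g(m) ≤ g(1)` for `1 ≤ m ≤ (L+1)/2`;

— give `tCorr_one_ge_of_abs`: **a floor `δ ≤ |g(m)|` at ANY separation `1 ≤ m ≤ (L+1)/2` forces
`δ ≤ g(1)`** (the sign takes care of itself: `g(1) = 0` would kill `g(m)`, and `g(1) > 0` makes
every `g(n) > 0`).  Consequences, for continuous `ρ` and a transverse axis `a ∉ {i, j}`:

* `crossCutCorrelatorFloor_zero_of_sep(_transverse)` — (U′) at ANY `R` ⇒ (U′) at `R = 0`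
  (`β ≥ 0`, same `δ`, `L₀' = max L₀ (4R + 3)`);
* `clusteringFloor_of_crossCut_sep` — **(U′) at any single `R` ⇒ (U″)** (`β > 0`);
* **`clusteringFloor_iff_crossCut`** — `ClusteringFloor d N G ρ β i j a ↔
  CrossCutCorrelatorFloor d N G ρ β R i j a` for EVERY `R`, and
  **`crossCutCorrelatorFloor_iff_of_sep`** — `CrossCutCorrelatorFloor … R i j a ↔
  CrossCutCorrelatorFloor … R' i j a` for all `R, R'` (`β > 0`); repaired form
  `clusteringFloorR_of_crossCutR`.

So at each `β > 0` THEORY-2's volume-law hypotheses (U′)_R (`R = 0, 1, 2, …`) and (U″) are a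
SINGLE conjecture: a volume-uniform floor under the truncated correlator of two parallel spatial
plaquettes at any one fixed transverse separation.  NOT CLAIMED: `a ∈ {i, j}`; `β < 0`; any value
of the floor at intermediate `β`.  [folklore] mechanism (reflection positivity ⇒ log-convexity);
new docking.
-/

noncomputable section

namespace Summit.Ventures.LatticeQCDFlow.Theory2.Clustering

open MeasureTheory Literature.MathematicalPhysics.QuantumFieldTheory
open Summit.Ventures.LatticeQCDFlow.Conjectures

/-! ## §1 Three facts about log-convex sequences -/

section Sequence

/-- **Zeros propagate**: if `g(n)² ≤ g(n−1) g(n+1)` for `1 ≤ n ≤ M − 1` and `g(1) = 0`, then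
`g(k) = 0` for every `1 ≤ k ≤ M − 1`. [folklore] -/
theorem logConvex_eq_zero_of_one_eq_zero {g : ℕ → ℝ} {M : ℕ}
    (hconv : ∀ n, 1 ≤ n → n + 1 ≤ M → g n ^ 2 ≤ g (n - 1) * g (n + 1)) (h1 : g 1 = 0) :
    ∀ k, 1 ≤ k → k + 1 ≤ M → g k = 0 := by
  intro k hk hkM
  induction k, hk using Nat.le_induction with
  | base => exact h1
  | succ k hk ih =>
    have hz : g k = 0 := ih (by omega)
    have hc := hconv (k + 1) (by omega) hkM
    rw [Nat.add_sub_cancel, hz, zero_mul] at hc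
    exact pow_eq_zero_iff (two_ne_zero) |>.mp (le_antisymm hc (sq_nonneg _))

/-- **Ratios of a positive log-convex sequence are non-decreasing** (chained, division-free form):
`g(a) · g(b−1) ≤ g(b) · g(a−1)` for `1 ≤ a ≤ b ≤ M`. [folklore] -/
theorem ratio_le_of_logConvex {g : ℕ → ℝ} {M : ℕ} (hpos : ∀ n, n ≤ M → 0 < g n)
    (hconv : ∀ n, 1 ≤ n → n + 1 ≤ M → g n ^ 2 ≤ g (n - 1) * g (n + 1)) :
    ∀ a b, 1 ≤ a → a ≤ b → b ≤ M → g a * g (b - 1) ≤ g b * g (a - 1) := by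
  intro a b ha hab hbM
  induction b, hab using Nat.le_induction with
  | base => exact le_rfl
  | succ b hab ih =>
    have ih := ih (by omega)
    have hc := hconv b (by omega) hbM
    have hbm : 0 < g (b - 1) := hpos (b - 1) (by omega)
    have hb : 0 < g b := hpos b (by omega)
    have ha1 : 0 < g (a - 1) := hpos (a - 1) (by omega)
    rw [Nat.add_sub_cancel]
    refine le_of_mul_le_mul_left ?_ hbm
    calc g (b - 1) * (g a * g b) = (g a * g (b - 1)) * g b := by ring
      _ ≤ (g b * g (a - 1)) * g b := mul_le_mul_of_nonneg_right ih hb.le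
      _ = g (a - 1) * g b ^ 2 := by ring
      _ ≤ g (a - 1) * (g (b - 1) * g (b + 1)) := mul_le_mul_of_nonneg_left hc ha1.le
      _ = g (b - 1) * (g (b + 1) * g (a - 1)) := by ring

/-- **A positive, log-convex, `L`-symmetric sequence is non-increasing up to the middle**:
with `g(L − a) = g(a)` (`a ≤ L`) and log-convexity on `[1, L−2]`, `g(k) ≤ g(k−1)` for
`2 ≤ k ≤ (L+1)/2` (the ratio at `k` is at most the ratio at `L+1−k`, which is its inverse).
[folklore] -/
theorem le_pred_of_logConvex_symm {g : ℕ → ℝ} {L : ℕ} (hpos : ∀ n, n ≤ L - 1 → 0 < g n)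
    (hconv : ∀ n, 1 ≤ n → n + 1 ≤ L - 1 → g n ^ 2 ≤ g (n - 1) * g (n + 1))
    (hsym : ∀ a, a ≤ L → g (L - a) = g a) {k : ℕ} (hk2 : 2 ≤ k) (hk : 2 * k ≤ L + 1) :
    g k ≤ g (k - 1) := by
  have hr := ratio_le_of_logConvex hpos hconv k (L + 1 - k) (by omega) (by omega) (by omega)
  have e1 : g (L + 1 - k) = g (k - 1) := by
    rw [show L + 1 - k = L - (k - 1) by omega, hsym (k - 1) (by omega)]
  have e2 : g (L + 1 - k - 1) = g k := by
    rw [show L + 1 - k - 1 = L - k by omega, hsym k (by omega)]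
  rw [e1, e2] at hr
  have hk0 : 0 < g k := hpos k (by omega)
  have hk1 : 0 < g (k - 1) := hpos (k - 1) (by omega)
  nlinarith [hr, hk0, hk1]

/-- Hence `g(m) ≤ g(1)` for every `1 ≤ m ≤ (L+1)/2` (and `g(1) ≤ g(0)` is separate). [folklore] -/
theorem le_one_of_logConvex_symm {g : ℕ → ℝ} {L : ℕ} (hpos : ∀ n, n ≤ L - 1 → 0 < g n)
    (hconv : ∀ n, 1 ≤ n → n + 1 ≤ L - 1 → g n ^ 2 ≤ g (n - 1) * g (n + 1))
    (hsym : ∀ a, a ≤ L → g (L - a) = g a) :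
    ∀ m, 1 ≤ m → 2 * m ≤ L + 1 → g m ≤ g 1 := by
  intro m hm1
  induction m, hm1 using Nat.le_induction with
  | base => intro; exact le_rfl
  | succ m hm1 ih =>
    intro hm
    have h := le_pred_of_logConvex_symm hpos hconv hsym (k := m + 1) (by omega) hm
    rw [Nat.add_sub_cancel] at h
    exact h.trans (ih (by omega))

end Sequence

/-! ## §2 On one torus: a floor at any separation up to the middle is a floor at separation one -/

section Torus

variable {d L N : ℕ} [NeZero d] [NeZero L] {G : Type*} [Group G] [TopologicalSpace G]
  [IsTopologicalGroup G] [CompactSpace G] [MeasurableSpace G] [BorelSpace G]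
  [SecondCountableTopology G] (ρ : G →* Matrix (Fin N) (Fin N) ℂ)

/-- **`δ ≤ |g(m)|` AT ANY SEPARATION `1 ≤ m ≤ (L+1)/2` FORCES `δ ≤ g(1)`** (`L ≥ 3`, `β ≥ 0`,
time-zero base site, spatial orientation `i, j ≠ 0`).  If `g(1) = 0` every interior `g(m)`
vanishes (zeros propagate along the log-convexity chain; `m = L − 1` by periodicity); otherwise
`g(0) ≥ g(1) > 0` makes the whole sequence positive and non-increasing up to the middle. -/
theorem tCorr_one_ge_of_abs (hL3 : 3 ≤ L) (hρ : Continuous ρ) {β : ℝ} (hβ : 0 ≤ β)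
    {x : Site d L} (hx : x 0 = 0) {i j : Fin d} (hi : i ≠ 0) (hj : j ≠ 0) {m : ℕ} (hm1 : 1 ≤ m)
    (hm : 2 * m ≤ L + 1) {δ : ℝ} (hδ : 0 < δ)
    (hδm : δ ≤ |tCorr ρ β x i j ((m : ℕ) : ZMod L)|) : δ ≤ tCorr ρ β x i j 1 := by
  set g : ℕ → ℝ := fun k => tCorr ρ β x i j ((k : ℕ) : ZMod L) with hg
  have hg0 : g 0 = tCorr ρ β x i j 0 := by simp [hg]
  have hg1 : g 1 = tCorr ρ β x i j 1 := by simp [hg]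
  have hgm : g m = tCorr ρ β x i j ((m : ℕ) : ZMod L) := rfl
  have hconv : ∀ k, 1 ≤ k → k + 1 ≤ L - 1 → g k ^ 2 ≤ g (k - 1) * g (k + 1) := fun k hk1 hk =>
    sq_tCorr_le ρ hL3 hρ hβ hx hi hj hk1 (by omega)
  have hsym : ∀ a, a ≤ L → g (L - a) = g a := fun a ha => tCorr_sub_eq ρ β x i j ha
  have h1nn : 0 ≤ g 1 := by
    rw [hg1]; exact corr_one_nonneg ρ (by omega : 2 ≤ L) hρ hβ hx hi hj
  rw [← hgm] at hδm
  rw [← hg1]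
  rcases h1nn.eq_or_lt with h1 | h1
  · -- `g 1 = 0` kills `g m`: contradiction with the floor
    exfalso
    have hz : g m = 0 := by
      rcases Nat.lt_or_ge (m + 1) L with hmL | hmL
      · exact logConvex_eq_zero_of_one_eq_zero hconv h1.symm m hm1 (by omega)
      · have hmeq : m = L - 1 := by omega
        rw [hmeq, hsym 1 (by omega)]
        exact h1.symm
    rw [hz, abs_zero] at hδm
    exact absurd hδm (not_le.2 hδ)
  · have h1t : 0 < tCorr ρ β x i j 1 := hg1 ▸ h1
    have h0 : 0 < g 0 := by
      have := tCorr_one_le_zero ρ hρ β x i j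
      rw [hg0]; linarith
    have hpos : ∀ n, n ≤ L - 1 → 0 < g n := fun n hn =>
      (geom_lower_of_logConvex h0 h1 hconv n hn).1
    have hmle : g m ≤ g 1 := le_one_of_logConvex_symm hpos hconv hsym m hm1 hm
    rw [abs_of_pos (hpos m (by omega))] at hδm
    exact hδm.trans hmle

end Torus

/-! ## §3 (U′) at any `R` ⇒ (U′) at `R = 0` ⇒ (U″); all (U′)_R are equivalent -/

section Conjecture

variable {d N : ℕ} [NeZero d] {G : Type} [Group G] [TopologicalSpace G] [IsTopologicalGroup G]
  [CompactSpace G] [MeasurableSpace G] [BorelSpace G] [SecondCountableTopology G]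
  (ρ : G →* Matrix (Fin N) (Fin N) ℂ)

/-- **(U′) AT ANY `R` ⇒ (U′) AT `R = 0`, time axis** (continuous `ρ`, `β ≥ 0`, spatial
orientation `i, j ≠ 0`; same `δ`, `L₀' = max L₀ (4R + 3)`). -/
theorem crossCutCorrelatorFloor_zero_of_sep (hρ : Continuous ρ) {β : ℝ} (hβ : 0 ≤ β)
    {i j : Fin d} (hi : i ≠ 0) (hj : j ≠ 0) {R : ℕ}
    (hU : CrossCutCorrelatorFloor d N G ρ β R i j 0) : CrossCutCorrelatorFloor d N G ρ β 0 i j 0 := by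
  obtain ⟨δ, hδ, L₀, hU⟩ := hU
  refine ⟨δ, hδ, max L₀ (4 * R + 3), fun L _ hL x => ?_⟩
  have hLR : 4 * R + 3 ≤ L := le_of_max_le_right hL
  have hL0 : L₀ ≤ L := le_of_max_le_left hL
  have h := hU L hL0 x
  rw [conjCorr_eq_tCorr ρ β x i j (2 * R + 1)] at h
  rw [conjCorr_eq_tCorr ρ β x i j (2 * 0 + 1)]
  set x₀ : Site d L := x - Pi.single (0 : Fin d) (x 0) with hx₀
  have hx₀0 : x₀ 0 = 0 := by simp [hx₀]
  have h1 := tCorr_one_ge_of_abs ρ (by omega) hρ hβ hx₀0 hi hj (m := 2 * R + 1) (by omega)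
    (by omega) hδ h
  have e : ((2 * 0 + 1 : ℕ) : ZMod L) = 1 := by norm_num
  rw [e]
  exact h1.trans (le_abs_self _)

/-- **(U′) AT ANY `R` ⇒ (U′) AT `R = 0`, every transverse axis `a ∉ {i, j}`** (axis permutation
to the time direction and back). -/
theorem crossCutCorrelatorFloor_zero_of_sep_transverse (hρ : Continuous ρ) {β : ℝ} (hβ : 0 ≤ β)
    {i j a : Fin d} (hai : a ≠ i) (haj : a ≠ j) {R : ℕ}
    (hU : CrossCutCorrelatorFloor d N G ρ β R i j a) : CrossCutCorrelatorFloor d N G ρ β 0 i j a := by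
  set π : Equiv.Perm (Fin d) := Equiv.swap 0 a with hπ
  have hπ0 : π 0 = a := by simp [hπ]
  have hπa : π a = 0 := by simp [hπ]
  have hi0 : π i ≠ 0 := by
    intro h
    have : i = π.symm 0 := by rw [← h, Equiv.symm_apply_apply]
    rw [Equiv.symm_swap, Equiv.swap_apply_left] at this
    exact hai this.symm
  have hj0 : π j ≠ 0 := by
    intro h
    have : j = π.symm 0 := by rw [← h, Equiv.symm_apply_apply]
    rw [Equiv.symm_swap, Equiv.swap_apply_left] at this
    exact haj this.symm
  have hππ : ∀ k, π (π k) = k := fun k => by simp [hπ, Equiv.swap_apply_self]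
  have hU' : CrossCutCorrelatorFloor d N G ρ β R (π i) (π j) 0 := by
    have h := crossCutCorrelatorFloor_perm ρ hρ π hU
    rwa [hπa] at h
  have h0 := crossCutCorrelatorFloor_zero_of_sep ρ hρ hβ hi0 hj0 hU'
  have h := crossCutCorrelatorFloor_perm ρ hρ π h0
  rwa [hππ, hππ, hπ0] at h

/-- **(U′) AT ANY SINGLE `R` ⇒ (U″)** (`β > 0`, continuous `ρ`, transverse axis). -/
theorem clusteringFloor_of_crossCut_sep (hρ : Continuous ρ) {β : ℝ} (hβ : 0 < β) {i j a : Fin d}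
    (hai : a ≠ i) (haj : a ≠ j) {R : ℕ} (hU : CrossCutCorrelatorFloor d N G ρ β R i j a) :
    ClusteringFloor d N G ρ β i j a :=
  clusteringFloor_of_crossCut_transverse ρ hρ hβ hai haj
    (crossCutCorrelatorFloor_zero_of_sep_transverse ρ hρ hβ.le hai haj hU)

/-- **(U″) ⇔ (U′) AT `R`, FOR EVERY `R`** (`β > 0`, continuous `ρ`, transverse axis). -/
theorem clusteringFloor_iff_crossCut (hρ : Continuous ρ) {β : ℝ} (hβ : 0 < β) {i j a : Fin d}
    (hai : a ≠ i) (haj : a ≠ j) (R : ℕ) :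
    ClusteringFloor d N G ρ β i j a ↔ CrossCutCorrelatorFloor d N G ρ β R i j a :=
  ⟨fun h => crossCutCorrelatorFloor_of_clusteringFloor ρ h R,
    fun h => clusteringFloor_of_crossCut_sep ρ hρ hβ hai haj h⟩

/-- **ALL THE (U′)_R ARE EQUIVALENT** at each `β > 0` (continuous `ρ`, transverse axis):
`CrossCutCorrelatorFloor … R i j a ↔ CrossCutCorrelatorFloor … R' i j a`. -/
theorem crossCutCorrelatorFloor_iff_of_sep (hρ : Continuous ρ) {β : ℝ} (hβ : 0 < β)
    {i j a : Fin d} (hai : a ≠ i) (haj : a ≠ j) (R R' : ℕ) :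
    CrossCutCorrelatorFloor d N G ρ β R i j a ↔ CrossCutCorrelatorFloor d N G ρ β R' i j a :=
  (clusteringFloor_iff_crossCut ρ hρ hβ hai haj R).symm.trans
    (clusteringFloor_iff_crossCut ρ hρ hβ hai haj R')

/-- Repaired forms: **(U′-R) at any `R` ⇒ (U″-R)** (transverse axis). -/
theorem clusteringFloorR_of_crossCutR (hρ : Continuous ρ) {β : ℝ} {i j a : Fin d} (hai : a ≠ i)
    (haj : a ≠ j) {R : ℕ} (hU : CrossCutCorrelatorFloorR d N G ρ β R i j a) :
    ClusteringFloorR d N G ρ β i j a :=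
  fun hd hij hβ hnt => clusteringFloor_of_crossCut_sep ρ hρ hβ hai haj (hU.floor hd hij hβ hnt)

end Conjecture

end Summit.Ventures.LatticeQCDFlow.Theory2.Clustering
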